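import Literature.AnabelianGeometry.AbsoluteAnabelian.AbsTopIII.BiAnabelianCompatibilityGlue
import Literature.AnabelianGeometry.AbsoluteAnabelian.AbsTopIII.BiAnabelianTelecoreProofs

/-!
# [AbsTopIII] Cor. 3.7 (iii), second clause — the telecore family `𝒥` of `𝔗_δ` lies in the glue family `K₁`

[cite: MochizukiAbsTopIII2015, Cor 3.7 (ii) p.87] [cite: MochizukiAbsTopIII2015, Cor 3.7 (iii) p.88]

abc-iut-L4-t5 (gen 6), row «COR37-COMPAT-LITERAL», part (d) (telecore half of (iii), second clause: "[the
`𝔖†_log` family] is compatible with the families of homotopies that constitute the [...] telecore structures of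
[...] (ii)").  For every `𝔖 : BiAnabelianSetting X E N` and every bi-anabelian lift datum `θ^bi`, the family `𝒥`
of abc-iut-L4-t12's telecore `𝔗_δ = teleT θ` (`BiAnabelianTelecoreProofs`: boundary set = the core-suffix pairs
`([γ₃]∘[γ₁], [γ₃]∘[γ₂])` of `𝒟‡_δ`, homotopies = the universal ones over `𝒳`) is CONTAINED, along the embedding
`𝒟‡_δ ↪ 𝒟*` (`embTele`), in the glue family `K₁ = glueFamily` of `BiAnabelianCompatibilityGlue` (pairs through `𝔈`
or through `𝒳`): a core-suffix pair maps to a pair through `𝒳`, and on such pairs BOTH families carry the identity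
homotopy (`eqToHom` of the equality of the two path functors: "the second factor `𝒳` is a universal reference
model" — all path functors into the core vertex coincide).  Consequently ANY family on `𝒟*` containing `K₁` with
the same homotopies and realising the `𝔖†_log` family realises the typed telecore half
`LogObsCompatTelecoreStmt` (`logObsCompatTelecoreStmt_of_glueFamily_le`) — the form in which abc-iut-w5-d053's glue
family `K₂ ⊇ K₁` (row «COR37-LOGOBS-GLUE») discharges it.  Proof-only; model-level bookkeeping over
abc-iut-L4-t9's abstract setting; nothing here bears on [IUTchIII] Cor. 3.12.
-/

set_option autoImplicit false

namespace Literature.AnabelianGeometry.AbsoluteAnabelian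

open CategoryTheory Quiver

universe u

namespace DiagramOfCategories

/-- **A sub-family witnesses compatibility**: if `H` is compatible with `K₁` along `F` and every homotopy of `K₁`
is a homotopy of `K₂` (same boundary pair, same natural transformation), then `H` is compatible with `K₂` along
`F` (Def. 3.5 (ii): "there exists a family containing them"). [cite: MochizukiAbsTopIII2015, Definition 3.5 (ii) p.75] -/
theorem HomotopyFamily.CompatibleAlong.of_le {V : Type*} [Quiver V] {V' : Type*} [Quiver V']
    {D' : DiagramOfCategories V'} {D : DiagramOfCategories V} {F : V' ⥤q V} {H : D'.HomotopyFamily}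
    {K₁ K₂ : D.HomotopyFamily} (h₁ : H.CompatibleAlong F K₁)
    (h₁₂ : ∀ ⦃a b : V⦄ ⦃P Q : Path a b⦄ (h : K₁.E P Q), ∃ h' : K₂.E P Q, K₁.η h = K₂.η h') :
    H.CompatibleAlong F K₂ := by
  intro a b p q h
  obtain ⟨h', hη⟩ := h₁ p q h
  obtain ⟨h'', hη'⟩ := h₁₂ h'
  exact ⟨h'', hη.trans (heq_of_eq hη')⟩

end DiagramOfCategories

namespace AbsTopIII

open Literature.AnabelianGeometry.AbsoluteAnabelian.DiagramOfCategories

/-- `eqToHom`s between pairwise equal objects are heterogeneously equal. [folklore] -/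
private theorem eqToHom_heq_eqToHom {C : Type*} [Category C] {A B A' B' : C} (hA : A = A')
    (hB : B = B') (h : A = B) (h' : A' = B') : HEq (eqToHom h) (eqToHom h') := by
  subst hA; subst hB; rfl

namespace BiAnabelianSetting

variable {X E N : Type u} [Category.{u} X] [Category.{u} E] [Category.{u} N]
  (𝔖 : BiAnabelianSetting X E N) (θ : FiberSquare.BiAnabelianLift 𝔖.gal)

/-! ## `𝒟‡_δ` is the pulled-back diagram `embTele^*𝒟*` -/

/-- The embedding `𝒟‡_δ ↪ 𝒟*` never reaches `𝔈` (it stays in row 1 and the core vertex).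
[cite: MochizukiAbsTopIII2015, Cor 3.7 (ii) p.87] -/
theorem embTele_obj_ne_galois (b : 𝔖.teleShape.Vertex) : (embTele (𝔖.teleT θ)).obj b ≠ .galois := by
  rcases b with ⟨_ | _ | _ | _ | _, hv⟩ | _
  · exact fun h => Cor37Vertex.noConfusion h
  · exact fun h => Cor37Vertex.noConfusion h
  · exact fun h => Cor37Vertex.noConfusion h
  · exact absurd hv.2 (by decide)
  · exact fun h => Cor37Vertex.noConfusion h
  · exact fun h => Cor37Vertex.noConfusion h

/-- **`𝒟‡_δ` IS `embTele^*𝒟*`** (same categories at the vertices, same functors `log_𝒳`, `π_⋎`, `δ_⋎` on the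
edges). [cite: MochizukiAbsTopIII2015, Cor 3.7 (ii) p.87] -/
theorem teleDiag_eq_comapAlong : 𝔖.teleDiag = 𝔖.starDiagram.comapAlong (embTele (𝔖.teleT θ)) :=
  𝔖.starDiagram.eq_comapAlong (embTele (𝔖.teleT θ)) (fun a => by rcases a with _ | _ <;> rfl)
    (fun a => by rcases a with _ | _ <;> exact HEq.rfl)
    (fun e => by
      rename_i a b
      revert e
      rcases a with ⟨_ | _ | _ | _ | _, _⟩ | _ <;> rcases b with ⟨_ | _ | _ | _ | _, _⟩ | _ <;> intro e <;>
        first | exact (PEmpty.elim e) | exact HEq.rfl)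

/-- Hence the path functors of `𝒟‡_δ` ARE those of `𝒟*` along the embedding (heterogeneously).
[cite: MochizukiAbsTopIII2015, Cor 3.7 (ii) p.87] -/
theorem teleDiag_pathFunctor_heq {a b : 𝔖.teleShape.Vertex} (p : Path a b) :
    HEq (𝔖.teleDiag.pathFunctor p) (𝔖.starDiagram.pathFunctor ((embTele (𝔖.teleT θ)).mapPath p)) :=
  (pathFunctor_heq_of_eq (𝔖.teleDiag_eq_comapAlong θ) p).trans
    (heq_of_eq (𝔖.starDiagram.pathFunctor_comapAlong (embTele (𝔖.teleT θ)) p))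

/-! ## The telecore homotopies are identities -/

/-- All path functors of `𝒟‡_δ` into the core vertex coincide (they all equal the canonical functor to `𝒳`:
"the second factor `𝒳` is a universal reference model"). [cite: MochizukiAbsTopIII2015, Cor 3.7 (ii) p.87] -/
theorem telePathFunctor_eq_of_obs {a : 𝔖.teleShape.Vertex} (p q : Path a 𝔖.teleShape.obs) :
    𝔖.teleDiag.pathFunctor p = 𝔖.teleDiag.pathFunctor q :=
  ((𝔖.teleDiag.pathFunctor p).comp_id.symm.trans (𝔖.telePathFunctor_comp_toRef p)).trans
    ((𝔖.teleDiag.pathFunctor q).comp_id.symm.trans (𝔖.telePathFunctor_comp_toRef q)).symm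

/-- Hence the two paths of a core-suffix pair `([γ₃]∘[γ₁], [γ₃]∘[γ₂])` have THE SAME functor.
[cite: MochizukiAbsTopIII2015, Definition 3.5 (iv) p.76] -/
theorem telePathFunctor_eq_of_comp {a b : 𝔖.teleShape.Vertex} (p₁ q₁ : Path a 𝔖.teleShape.obs)
    (r : Path 𝔖.teleShape.obs b) :
    𝔖.teleDiag.pathFunctor (p₁.comp r) = 𝔖.teleDiag.pathFunctor (q₁.comp r) := by
  rw [pathFunctor_comp, pathFunctor_comp, 𝔖.telePathFunctor_eq_of_obs p₁ q₁]

/-- The universal homotopy of `𝒟‡_δ` between EQUAL path functors is the identity `eqToHom` (uniqueness: the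
`eqToHom` lies over the identity shadow in `𝒳`). [cite: MochizukiAbsTopIII2015, Cor 3.7 (ii) p.87] -/
theorem teleη_eq_eqToHom {a b : 𝔖.teleShape.Vertex} (p q : Path a b)
    (e : 𝔖.teleDiag.pathFunctor p = 𝔖.teleDiag.pathFunctor q) : 𝔖.teleη θ p q = eqToHom e :=
  (𝔖.teleη_eq θ (eqToHom e) fun x => by rw [eqToHom_app, eqToHom_map]).symm

/-- In particular EVERY homotopy of the telecore family `𝒥` of `𝔗_δ` is an identity `eqToHom`.
[cite: MochizukiAbsTopIII2015, Cor 3.7 (ii) p.87] -/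
theorem teleJfam_η_eq_eqToHom {a b : 𝔖.teleShape.Vertex} {p q : Path a b} (h : (𝔖.teleJfam θ).E p q) :
    ∃ e : 𝔖.teleDiag.pathFunctor p = 𝔖.teleDiag.pathFunctor q, (𝔖.teleJfam θ).η h = eqToHom e := by
  obtain ⟨p₁, q₁, r, rfl, rfl⟩ := h
  exact ⟨𝔖.telePathFunctor_eq_of_comp p₁ q₁ r, 𝔖.teleη_eq_eqToHom θ _ _ _⟩

/-! ## `𝒥 ⊆ K₁` along `𝒟‡_δ ↪ 𝒟*` -/

/-- A core-suffix pair of `𝒟‡_δ` maps to a pair of `𝒟*` through the core vertex `𝒳`, i.e. into the boundary set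
of `K₁`. [cite: MochizukiAbsTopIII2015, Cor 3.7 (iii) p.88] -/
theorem glueFamily_E_mapPath_of_teleJE {a b : 𝔖.teleShape.Vertex} {p q : Path a b}
    (h : (𝔖.teleJfam θ).E p q) :
    𝔖.glueFamily.E ((embTele (𝔖.teleT θ)).mapPath p) ((embTele (𝔖.teleT θ)).mapPath q) := by
  obtain ⟨p₁, q₁, r, rfl, rfl⟩ := h
  exact ⟨⟨.ref, Or.inr rfl, (embTele (𝔖.teleT θ)).mapPath p₁, (embTele (𝔖.teleT θ)).mapPath q₁,
    (embTele (𝔖.teleT θ)).mapPath r, Prefunctor.mapPath_comp _ _ _, Prefunctor.mapPath_comp _ _ _⟩⟩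

/-- **The telecore family `𝒥` of `𝔗_δ` is contained in the glue family `K₁` along `𝒟‡_δ ↪ 𝒟*`** (Def. 3.5 (ii)
compatibility across the embedding): both carry the identity homotopy on the core-suffix pairs.
[cite: MochizukiAbsTopIII2015, Cor 3.7 (iii) p.88] -/
theorem teleJfam_compatibleAlong_glueFamily :
    (𝔖.teleT θ).Jfam.CompatibleAlong (embTele (𝔖.teleT θ)) 𝔖.glueFamily := by
  intro a b p q h
  have h' := 𝔖.glueFamily_E_mapPath_of_teleJE θ h
  refine ⟨h', ?_⟩
  obtain ⟨e, he⟩ := 𝔖.teleJfam_η_eq_eqToHom θ h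
  have hP := 𝔖.teleDiag_pathFunctor_heq θ p
  have hQ := 𝔖.teleDiag_pathFunctor_heq θ q
  change HEq ((𝔖.teleJfam θ).η h) (𝔖.glueη h')
  rw [he, 𝔖.glueη_of_not h' (𝔖.embTele_obj_ne_galois θ b)]
  clear he
  revert e hP hQ
  generalize 𝔖.teleDiag.pathFunctor p = P₁
  generalize 𝔖.teleDiag.pathFunctor q = Q₁
  rcases a with _ | _ <;> rcases b with _ | _ <;>
  · intro e hP hQ
    exact eqToHom_heq_eqToHom (eq_of_heq hP) (eq_of_heq hQ) _ _

/-! ## Consequence for Cor. 3.7 (iii), second clause (telecore half) -/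

/-- **The telecore half of (iii), second clause, from any family containing `K₁` and `𝔖†_log`**: if a family `K`
on `𝒟*` contains every homotopy of the glue family `K₁` and contains (along `𝒟†_{≤3} ↪ 𝒟*`) an `𝔖†_log` family,
then `LogObsCompatTelecoreStmt` holds — witnessed by the natural `𝒳`-core of (i), the telecore `𝔗_δ` of (ii)
(printed shape) and `K`. [cite: MochizukiAbsTopIII2015, Cor 3.7 (iii) p.88] -/
theorem logObsCompatTelecoreStmt_of_glueFamily_le (θ : FiberSquare.BiAnabelianLift 𝔖.gal)
    (K : 𝔖.starDiagram.HomotopyFamily)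
    (hK : ∀ ⦃a b : Cor37Vertex⦄ ⦃P Q : Path a b⦄ (h : 𝔖.glueFamily.E P Q), ∃ h' : K.E P Q,
      𝔖.glueFamily.η h = K.η h')
    (hobs : ∃ H : 𝔖.logObsDiagram.HomotopyFamily, 𝔖.IsLogObservableFamily H ∧ H.CompatibleAlong embLog K) :
    𝔖.LogObsCompatTelecoreStmt :=
  ⟨𝔖.refCoreFamily, 𝔖.refCoreFamily_terminal, 𝔖.refCoreObs_isCore, 𝔖.teleT θ, 𝔖.teleT_isTelecoreDelta θ, K,
    (𝔖.teleJfam_compatibleAlong_glueFamily θ).of_le hK, hobs⟩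

/-- The same with the containment `K₁ ⊆ K` given heterogeneously (the form produced by inductive glue
constructions). [cite: MochizukiAbsTopIII2015, Cor 3.7 (iii) p.88] -/
theorem logObsCompatTelecoreStmt_of_glueFamily_le' (θ : FiberSquare.BiAnabelianLift 𝔖.gal)
    (K : 𝔖.starDiagram.HomotopyFamily)
    (hK : ∀ ⦃a b : Cor37Vertex⦄ ⦃P Q : Path a b⦄ (h : 𝔖.glueFamily.E P Q), ∃ h' : K.E P Q,
      HEq (𝔖.glueFamily.η h) (K.η h'))
    (hobs : ∃ H : 𝔖.logObsDiagram.HomotopyFamily, 𝔖.IsLogObservableFamily H ∧ H.CompatibleAlong embLog K) :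
    𝔖.LogObsCompatTelecoreStmt :=
by
  refine 𝔖.logObsCompatTelecoreStmt_of_glueFamily_le θ K (fun a b P Q h => ?_) hobs
  obtain ⟨h', hη⟩ := hK h
  exact ⟨h', eq_of_heq hη⟩

/-- **The glue family `K₁` alone already realises the telecore family together with the three cores** (every
setting): what remains of `LogObsCompatTelecoreStmt` is, as for the cores half, only the `𝔖†_log` conjunct.
[cite: MochizukiAbsTopIII2015, Cor 3.7 (iii) p.88] -/
theorem exists_realises_cores_refCore_and_telecore (θ : FiberSquare.BiAnabelianLift 𝔖.gal) :
    ∃ K : 𝔖.starDiagram.HomotopyFamily,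
    ((∃ H hH, (𝔖.galCoreObs H hH).IsCore ∧ H.CompatibleAlong embGalCore K) ∧
      (∃ H hH, (𝔖.refCoreObs H hH).IsCore ∧ H.CompatibleAlong embRefCore K) ∧
      (∃ H hH, (𝔖.starGalCoreObs H hH).IsCore ∧ H.CompatibleAlong embStarCore K)) ∧
    ∃ H₁ hH₁ hc, ∃ T : (𝔖.daggerLe 1).Telecore (𝔖.refCoreObs H₁ hH₁) hc,
      𝔖.IsTelecoreDelta T ∧ T.Jfam.CompatibleAlong (embTele T) K :=
  ⟨𝔖.glueFamily, 𝔖.glueFamily_realises_cores_and_refCore, 𝔖.refCoreFamily, 𝔖.refCoreFamily_terminal,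
    𝔖.refCoreObs_isCore, 𝔖.teleT θ, 𝔖.teleT_isTelecoreDelta θ, 𝔖.teleJfam_compatibleAlong_glueFamily θ⟩

end BiAnabelianSetting

end AbsTopIII

end Literature.AnabelianGeometry.AbsoluteAnabelian
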